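/-
Origin: expansion seat `planner-pub-hodgecm-pv05-0`, handover 2026-08-18T03:44:01Z (`HOME/pub-hodgecm-pv05/lean/Pv05/KernelOperator.lean`, md5 c41d2941, 295 lines);
landed by the gen-5 packager in gate run 19 as `HodgeCM/PerL34/KernelOperator.lean` (verbatim).
-/
/-
Origin: HOME/pub-hodgecm-pv05/lean/Pv05/KernelOperator.lean — session planner-pub-hodgecm-pv05-0 (unit pub-hodgecm-pv05,
DAG-NODE PROVER #05 of 15).  Intended final place: `HodgeCM/PerL34/KernelOperator.lean`
(namespace `HodgeCM.PerL34.KernelOperator`; rename the module `Pv05.KernelOperator` ↦ `HodgeCM.PerL34.KernelOperator`).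
DAG node N21 (HOME/LEMMAS.md §1): PerL v5 §3.3 paragraph, tex ll. 380–383.  Imports Mathlib only.
Every declaration below is closed (no placeholders, no new constants).
-/
import Mathlib

set_option autoImplicit false

/-!
# PerL v5 §3.3, ll. 380–383 — the theta-kernel operator `𝒯_Φ` (DAG node N21)

**The node (verbatim, tex ll. 380–383).** "For `\Phi\in\cS` let `\mathcal T_\Phi\colon L^2([\U(W)])\to L^2([G_U])`,
`(\mathcal T_\Phi v)(g):=\int_{[\U(W)]}\theta_\Phi(g,h) v(h)\,dh`. As `\theta_\Phi` is continuous on the compact space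
`[G_U]\times[\U(W)]`, `\mathcal T_\Phi` is Hilbert--Schmidt, hence bounded; and `\mathcal T_{\omega(h_0)\Phi}(R(h_0)v)
=\mathcal T_\Phi(v)` for `h_0\in\U(W)(\A)`, `R` the right regular representation."

**What is proved here (kernel-checked, Mathlib only, nothing posited).**  For compact spaces `X` (`= [G_U]`) and
`Y` (`= [\U(W)]`) carrying finite Borel measures `μ`, `ν`, and a continuous kernel `k : C(X × Y, ℂ)` (`= θ_Φ`):

* `kx k ν x ∈ L²(ν)` — the class of `y ↦ conj (k (x, y))`; `continuous_kx` — it depends continuously on `x`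
  (currying `C(X × Y, ℂ) → C(X, C(Y, ℂ))` + the bounded map `C(Y, ℂ) → L²(ν)`);
* `evalT k ν v x := ⟪kx k ν x, v⟫` and `evalT_eq_integral` — this IS `\int_Y k(x,y) v(y) dν(y)` (tex l. 380);
* `continuous_evalT` — `x ↦ (𝒯_k v)(x)` is continuous on `X`, and `norm_evalT_le` — the Cauchy–Schwarz bound
  `‖(𝒯_k v)(x)‖ ≤ ‖kx k ν x‖ · ‖v‖`;
* `opT k μ ν : Lp ℂ 2 ν →L[ℂ] Lp ℂ 2 μ` — `𝒯_k` as a BOUNDED linear operator `L²(ν) → L²(μ)` ("hence bounded",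
  l. 382), with `opT_apply_coeFn` (its value is a.e. the integral of l. 380) and `opT_eq_toLp` (it factors through
  `C(X, ℂ)`);
* `opK ν v : C(X × Y, ℂ) →L[ℂ] C(X, ℂ)`, `k ↦ 𝒯_k v` — bounded and LINEAR IN THE KERNEL (for node N18: with
  `v = χ`, `Φ ↦ ϑ_{T,χ}(Φ) = 𝒯_{θ_Φ} χ` is continuous as soon as `Φ ↦ θ_Φ ∈ C([G_U] × [T])` is, tex l. 347);
* `integral_kernel_comp_eq`, `opT_comp_eq` — the EQUIVARIANCE of l. 382–383 in measure-theoretic form: if `τ : Y → Y` preserves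
  `ν` and is a measurable embedding (right translation by `h_0` on `[\U(W)]`, invariance of the quotient measure)
  and `k'(x, y) = k(x, τ y)` (`= θ_{ω(h_0)Φ}(g,h) = θ_Φ(g, h h_0)`, tex l. 414), then
  `∫ k'(x,y) v(τ y) dν = ∫ k(x,y) v(y) dν`, i.e. `𝒯_{k'}(v ∘ τ) = 𝒯_k(v)`.

**Scope note.** "Hilbert–Schmidt" itself (the HS ideal / HS norm `‖k‖_{L²(μ⊗ν)}`) is not formalised — Mathlib has
no Hilbert–Schmidt class — and is not used downstream: Prop. 3.6 Step 1 (l. 421, node N23b) consumes only the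
boundedness of `𝒯_Φ`, which is proved here (indeed with the stronger statement that `𝒯_Φ v` is a CONTINUOUS
function on `X`).  The compactness of `[G_U]` and `[\U(W)]` (anisotropy; LEMMAS.md N21 deps, GAPS adv1-X2) enters
exactly as the hypotheses `[CompactSpace X] [CompactSpace Y] [IsFiniteMeasure μ] [IsFiniteMeasure ν]`.
The same engine gives node N18's "`ϑ_{T,χ}(Φ) = \int_{[T]} θ_Φ(g,t)χ(t)dt ∈ C([G_U])`" (l. 347): take `Y = [T]`,
`v = χ ∈ C([T]) ⊂ L²`.
-/

noncomputable section

namespace HodgeCM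
namespace PerL34
namespace KernelOperator

open MeasureTheory Topology ComplexConjugate
open scoped InnerProductSpace ENNReal

variable {X Y : Type*}

/-! ## Equivariance (tex ll. 382–383), integral form: `𝒯_{ω(h_0)Φ}(R(h_0)v) = 𝒯_Φ(v)` -/

section Equivariance

variable [MeasurableSpace Y]

/-- **Equivariance, integral form.** If `τ : Y → Y` preserves `ν` and is a measurable embedding (right translation
by `h_0` on `[\U(W)]`; invariance of the quotient measure), and the kernels satisfy `k'(x,y) = k(x, τ y)`
(`θ_{ω(h_0)Φ}(g,h) = θ_Φ(g, h h_0)`, tex l. 414), then for every function `v`,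
`∫ k'(x,y) v(τ y) dν(y) = ∫ k(x,y) v(y) dν(y)` — i.e. `𝒯_{k'}(R(h_0) v) = 𝒯_k(v)` pointwise in `x`. -/
theorem integral_kernel_comp_eq {ν : Measure Y} {τ : Y → Y} (hτ : MeasurePreserving τ ν ν)
    (hτe : MeasurableEmbedding τ) (k k' : X × Y → ℂ) (hk : ∀ x y, k' (x, y) = k (x, τ y))
    (v : Y → ℂ) (x : X) :
    ∫ y, k' (x, y) * v (τ y) ∂ν = ∫ y, k (x, y) * v y ∂ν := by
  simp_rw [hk]
  exact hτ.integral_comp hτe (fun y => k (x, y) * v y)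

end Equivariance

section Kernel

variable [TopologicalSpace X] [TopologicalSpace Y]

/-! ## The kernel sections `y ↦ \overline{k(x,y)}` as a continuous family in `L²(ν)` -/

/-- The conjugate kernel `(x,y) ↦ conj (k (x,y))` as a continuous map. -/
def kbar (k : C(X × Y, ℂ)) : C(X × Y, ℂ) :=
  ⟨fun p => conj (k p), Complex.continuous_conj.comp k.continuous⟩

/-- (Ported verbatim from the HodgeCMPerL package; no docstring in the source.) -/
@[simp] theorem kbar_apply (k : C(X × Y, ℂ)) (p : X × Y) : kbar k p = conj (k p) := rfl

variable [CompactSpace Y] [MeasurableSpace Y] [BorelSpace Y]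

/-- The section `y ↦ conj (k (x, y))` as an element of `L²(ν)`. -/
def kx (k : C(X × Y, ℂ)) (ν : Measure Y) [IsFiniteMeasure ν] (x : X) : Lp ℂ 2 ν :=
  ContinuousMap.toLp (E := ℂ) 2 ν ℂ ((kbar k).curry x)

/-- (Ported verbatim from the HodgeCMPerL package; no docstring in the source.) -/
theorem kx_coeFn (k : C(X × Y, ℂ)) (ν : Measure Y) [IsFiniteMeasure ν] (x : X) :
    (kx k ν x : Y → ℂ) =ᵐ[ν] fun y => conj (k (x, y)) :=
  (ContinuousMap.coeFn_toLp (E := ℂ) (p := 2) (𝕜 := ℂ) ν ((kbar k).curry x)).trans (by rfl)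

/-- `x ↦ kx k ν x` is continuous `X → L²(ν)` (uniform continuity of `k` in the compact variable `y`, packaged
as: currying `C(X × Y, ℂ) → C(X, C(Y, ℂ))` is a continuous map for the compact-open = sup-norm topology on
`C(Y, ℂ)`, and `C(Y, ℂ) → L²(ν)` is a bounded linear map). -/
theorem continuous_kx (k : C(X × Y, ℂ)) (ν : Measure Y) [IsFiniteMeasure ν] :
    Continuous (kx k ν) :=
  (ContinuousMap.toLp (E := ℂ) 2 ν ℂ).continuous.comp ((kbar k).curry).continuous

/-! ## The operator, pointwise: `(𝒯_k v)(x) = ⟪kx x, v⟫ = ∫ k(x,y) v(y) dν(y)` -/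

/-- `(𝒯_k v)(x)`, defined as the `L²(ν)` inner product of the kernel section with `v`. -/
def evalT (k : C(X × Y, ℂ)) (ν : Measure Y) [IsFiniteMeasure ν] (v : Lp ℂ 2 ν) (x : X) : ℂ :=
  ⟪kx k ν x, v⟫_ℂ

/-- **The defining formula (tex l. 380):** `(𝒯_k v)(x) = ∫_Y k(x,y) v(y) dν(y)`. -/
theorem evalT_eq_integral (k : C(X × Y, ℂ)) (ν : Measure Y) [IsFiniteMeasure ν] (v : Lp ℂ 2 ν) (x : X) :
    evalT k ν v x = ∫ y, k (x, y) * v y ∂ν := by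
  unfold evalT
  rw [L2.inner_def]
  apply integral_congr_ae
  filter_upwards [kx_coeFn k ν x] with y hy
  rw [hy]
  simp [mul_comm]

/-- `x ↦ (𝒯_k v)(x)` is continuous on `X`. -/
theorem continuous_evalT (k : C(X × Y, ℂ)) (ν : Measure Y) [IsFiniteMeasure ν] (v : Lp ℂ 2 ν) :
    Continuous (evalT k ν v) :=
  (continuous_kx k ν).inner continuous_const

/-- `v ↦ 𝒯_k v` is additive and homogeneous (it is an inner product in the second variable). -/
theorem evalT_add (k : C(X × Y, ℂ)) (ν : Measure Y) [IsFiniteMeasure ν] (v w : Lp ℂ 2 ν) (x : X) :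
    evalT k ν (v + w) x = evalT k ν v x + evalT k ν w x := inner_add_right _ _ _

/-- (Ported verbatim from the HodgeCMPerL package; no docstring in the source.) -/
theorem evalT_smul (k : C(X × Y, ℂ)) (ν : Measure Y) [IsFiniteMeasure ν] (c : ℂ) (v : Lp ℂ 2 ν) (x : X) :
    evalT k ν (c • v) x = c * evalT k ν v x := inner_smul_right _ _ _

/-- `𝒯_k v ∈ C(X, ℂ)`. -/
def evalTC (k : C(X × Y, ℂ)) (ν : Measure Y) [IsFiniteMeasure ν] (v : Lp ℂ 2 ν) : C(X, ℂ) :=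
  ⟨evalT k ν v, continuous_evalT k ν v⟩

/-- (Ported verbatim from the HodgeCMPerL package; no docstring in the source.) -/
@[simp] theorem evalTC_apply (k : C(X × Y, ℂ)) (ν : Measure Y) [IsFiniteMeasure ν] (v : Lp ℂ 2 ν) (x : X) :
    evalTC k ν v x = evalT k ν v x := rfl

/-! ## Bounds (Cauchy–Schwarz) and `𝒯_k` as a bounded operator; from here on `X` is compact too -/

section OnX

variable [CompactSpace X]

/-- Sup bound for the sections: `‖kx k ν x‖_{L²} ≤ ν(Y)^{1/2} · ‖k‖_∞`. -/
theorem norm_kx_le (k : C(X × Y, ℂ)) (ν : Measure Y) [IsFiniteMeasure ν] (x : X) :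
    ‖kx k ν x‖ ≤ (measureUnivNNReal ν : ℝ) ^ (2 : ℝ)⁻¹ * ‖k‖ := by
  have h2 : (2 : ℝ≥0∞).toReal⁻¹ = (2 : ℝ)⁻¹ := by norm_num
  have hb : ∀ᵐ y ∂ν, ‖(kx k ν x : Y → ℂ) y‖ ≤ ‖k‖ := by
    filter_upwards [kx_coeFn k ν x] with y hy
    rw [hy, Complex.norm_conj]
    exact k.norm_coe_le_norm (x, y)
  have := Lp.norm_le_of_ae_bound (norm_nonneg k) hb
  simpa [h2] using this

/-- Cauchy–Schwarz: `‖(𝒯_k v)(x)‖ ≤ ‖kx x‖ ‖v‖ ≤ ν(Y)^{1/2} ‖k‖_∞ ‖v‖₂`. -/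
theorem norm_evalT_le (k : C(X × Y, ℂ)) (ν : Measure Y) [IsFiniteMeasure ν] (v : Lp ℂ 2 ν) (x : X) :
    ‖evalT k ν v x‖ ≤ (measureUnivNNReal ν : ℝ) ^ (2 : ℝ)⁻¹ * ‖k‖ * ‖v‖ :=
  (norm_inner_le_norm _ _).trans (mul_le_mul_of_nonneg_right (norm_kx_le k ν x) (norm_nonneg v))

/-- (Ported verbatim from the HodgeCMPerL package; no docstring in the source.) -/
theorem norm_evalTC_le (k : C(X × Y, ℂ)) (ν : Measure Y) [IsFiniteMeasure ν] (v : Lp ℂ 2 ν) :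
    ‖evalTC k ν v‖ ≤ (measureUnivNNReal ν : ℝ) ^ (2 : ℝ)⁻¹ * ‖k‖ * ‖v‖ :=
  (ContinuousMap.norm_le _ (by positivity)).mpr (fun x => norm_evalT_le k ν v x)

/-- `v ↦ 𝒯_k v` as a bounded linear map `L²(ν) → C(X, ℂ)` (sup norm). -/
def opTC (k : C(X × Y, ℂ)) (ν : Measure Y) [IsFiniteMeasure ν] : Lp ℂ 2 ν →L[ℂ] C(X, ℂ) :=
  LinearMap.mkContinuous
    { toFun := evalTC k ν
      map_add' := fun v w => by ext x; simp [evalT_add]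
      map_smul' := fun c v => by ext x; simp [evalT_smul] }
    ((measureUnivNNReal ν : ℝ) ^ (2 : ℝ)⁻¹ * ‖k‖) (fun v => norm_evalTC_le k ν v)

/-- (Ported verbatim from the HodgeCMPerL package; no docstring in the source.) -/
@[simp] theorem opTC_apply (k : C(X × Y, ℂ)) (ν : Measure Y) [IsFiniteMeasure ν] (v : Lp ℂ 2 ν) (x : X) :
    opTC k ν v x = evalT k ν v x := rfl

/-- (Ported verbatim from the HodgeCMPerL package; no docstring in the source.) -/
theorem norm_opTC_le (k : C(X × Y, ℂ)) (ν : Measure Y) [IsFiniteMeasure ν] :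
    ‖opTC k ν‖ ≤ (measureUnivNNReal ν : ℝ) ^ (2 : ℝ)⁻¹ * ‖k‖ :=
  LinearMap.mkContinuous_norm_le _ (by positivity) _

/-! ## Linearity and continuity in the KERNEL (feeds node N18: `Φ ↦ ϑ_{T,χ}(Φ)` is continuous, tex l. 347) -/

omit [CompactSpace X] in
/-- (Ported verbatim from the HodgeCMPerL package; no docstring in the source.) -/
theorem kx_add (k₁ k₂ : C(X × Y, ℂ)) (ν : Measure Y) [IsFiniteMeasure ν] (x : X) :
    kx (k₁ + k₂) ν x = kx k₁ ν x + kx k₂ ν x := by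
  unfold kx
  rw [← map_add]
  congr 1
  ext y
  simp

omit [CompactSpace X] in
/-- (Ported verbatim from the HodgeCMPerL package; no docstring in the source.) -/
theorem kx_smul (c : ℂ) (k : C(X × Y, ℂ)) (ν : Measure Y) [IsFiniteMeasure ν] (x : X) :
    kx (c • k) ν x = (starRingEnd ℂ c) • kx k ν x := by
  unfold kx
  rw [← map_smul]
  congr 1
  ext y
  simp

omit [CompactSpace X] in
/-- (Ported verbatim from the HodgeCMPerL package; no docstring in the source.) -/
theorem evalT_add_kernel (k₁ k₂ : C(X × Y, ℂ)) (ν : Measure Y) [IsFiniteMeasure ν] (v : Lp ℂ 2 ν) (x : X) :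
    evalT (k₁ + k₂) ν v x = evalT k₁ ν v x + evalT k₂ ν v x := by
  unfold evalT
  rw [kx_add, inner_add_left]

omit [CompactSpace X] in
/-- (Ported verbatim from the HodgeCMPerL package; no docstring in the source.) -/
theorem evalT_smul_kernel (c : ℂ) (k : C(X × Y, ℂ)) (ν : Measure Y) [IsFiniteMeasure ν] (v : Lp ℂ 2 ν)
    (x : X) : evalT (c • k) ν v x = c * evalT k ν v x := by
  unfold evalT
  rw [kx_smul, inner_smul_left]
  simp

/-- For fixed `v ∈ L²(ν)` (e.g. `v = χ ∈ C([T])`, node N18), the kernel-to-function map `k ↦ 𝒯_k v`,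
`C(X × Y, ℂ) → C(X, ℂ)`, is a bounded linear map (sup norms): so if `Φ ↦ θ_Φ` is continuous into
`C([G_U] × [T])` (tex ll. 343–345), then `Φ ↦ ϑ_{T,χ}(Φ) = 𝒯_{θ_Φ} χ` is continuous into `C([G_U])` (l. 347). -/
def opK (ν : Measure Y) [IsFiniteMeasure ν] (v : Lp ℂ 2 ν) : C(X × Y, ℂ) →L[ℂ] C(X, ℂ) :=
  LinearMap.mkContinuous
    { toFun := fun k => evalTC k ν v
      map_add' := fun k₁ k₂ => by ext x; simp [evalT_add_kernel]
      map_smul' := fun c k => by ext x; simp [evalT_smul_kernel] }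
    ((measureUnivNNReal ν : ℝ) ^ (2 : ℝ)⁻¹ * ‖v‖) (fun k => by
      calc ‖evalTC k ν v‖ ≤ (measureUnivNNReal ν : ℝ) ^ (2 : ℝ)⁻¹ * ‖k‖ * ‖v‖ := norm_evalTC_le k ν v
        _ = (measureUnivNNReal ν : ℝ) ^ (2 : ℝ)⁻¹ * ‖v‖ * ‖k‖ := by ring)

/-- (Ported verbatim from the HodgeCMPerL package; no docstring in the source.) -/
@[simp] theorem opK_apply (ν : Measure Y) [IsFiniteMeasure ν] (v : Lp ℂ 2 ν) (k : C(X × Y, ℂ)) (x : X) :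
    opK ν v k x = evalT k ν v x := rfl

/-- Joint consequence: `k ↦ 𝒯_k v` is continuous `C(X × Y, ℂ) → C(X, ℂ)`. -/
theorem continuous_kernel_to_fun (ν : Measure Y) [IsFiniteMeasure ν] (v : Lp ℂ 2 ν) :
    Continuous fun k : C(X × Y, ℂ) => evalTC k ν v :=
  (opK ν v).continuous

variable [MeasurableSpace X] [BorelSpace X]

/-- **`𝒯_k` is a bounded operator `L²(ν) → L²(μ)`** (tex ll. 381–382: "hence bounded"). -/
def opT (k : C(X × Y, ℂ)) (μ : Measure X) [IsFiniteMeasure μ] (ν : Measure Y) [IsFiniteMeasure ν] :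
    Lp ℂ 2 ν →L[ℂ] Lp ℂ 2 μ :=
  (ContinuousMap.toLp (E := ℂ) 2 μ ℂ).comp (opTC k ν)

/-- (Ported verbatim from the HodgeCMPerL package; no docstring in the source.) -/
theorem opT_eq_toLp (k : C(X × Y, ℂ)) (μ : Measure X) [IsFiniteMeasure μ] (ν : Measure Y) [IsFiniteMeasure ν]
    (v : Lp ℂ 2 ν) : opT k μ ν v = ContinuousMap.toLp (E := ℂ) 2 μ ℂ (evalTC k ν v) := rfl

/-- The value of `𝒯_k v ∈ L²(μ)` is, `μ`-a.e. in `x`, the integral `∫_Y k(x,y) v(y) dν(y)` of tex l. 380. -/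
theorem opT_apply_coeFn (k : C(X × Y, ℂ)) (μ : Measure X) [IsFiniteMeasure μ] (ν : Measure Y)
    [IsFiniteMeasure ν] (v : Lp ℂ 2 ν) :
    (opT k μ ν v : X → ℂ) =ᵐ[μ] fun x => ∫ y, k (x, y) * v y ∂ν := by
  rw [opT_eq_toLp]
  filter_upwards [ContinuousMap.coeFn_toLp (E := ℂ) (p := 2) (𝕜 := ℂ) μ (evalTC k ν v)] with x hx
  rw [hx, evalTC_apply, evalT_eq_integral]

/-- Operator-norm bound `‖𝒯_k‖ ≤ μ(X)^{1/2} ν(Y)^{1/2} ‖k‖_∞` (the Hilbert–Schmidt norm bound would be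
`‖k‖_{L²(μ⊗ν)} ≤` the same quantity). -/
theorem norm_opT_le (k : C(X × Y, ℂ)) (μ : Measure X) [IsFiniteMeasure μ] (ν : Measure Y) [IsFiniteMeasure ν] :
    ‖opT k μ ν‖ ≤ (measureUnivNNReal μ : ℝ) ^ (2 : ℝ)⁻¹ * ((measureUnivNNReal ν : ℝ) ^ (2 : ℝ)⁻¹ * ‖k‖) := by
  have h2 : (2 : ℝ≥0∞).toReal⁻¹ = (2 : ℝ)⁻¹ := by norm_num
  have hT : ‖(ContinuousMap.toLp (E := ℂ) 2 μ ℂ : C(X, ℂ) →L[ℂ] Lp ℂ 2 μ)‖ ≤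
      (measureUnivNNReal μ : ℝ) ^ (2 : ℝ)⁻¹ := by
    have := ContinuousMap.toLp_norm_le (E := ℂ) (p := 2) μ (𝕜 := ℂ)
    rw [h2] at this
    exact_mod_cast this
  exact (ContinuousLinearMap.opNorm_comp_le _ _).trans
    (mul_le_mul hT (norm_opTC_le k ν) (norm_nonneg _) (by positivity))

/-! ## Equivariance for the bounded operators -/

/-- With `R_τ v := v ∘ τ` realised on `L²(ν)` by `Lp.compMeasurePreserving` (the right regular representation
at `h_0`), and `k'(x,y) = k(x, τ y)`: `𝒯_{k'} (R_τ v) = 𝒯_k v` in `L²(μ)` (tex ll. 382–383). -/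
theorem opT_comp_eq (μ : Measure X) [IsFiniteMeasure μ] {ν : Measure Y} [IsFiniteMeasure ν]
    {τ : Y → Y} (hτ : MeasurePreserving τ ν ν) (hτe : MeasurableEmbedding τ)
    (k k' : C(X × Y, ℂ)) (hk : ∀ x y, k' (x, y) = k (x, τ y)) (v : Lp ℂ 2 ν) :
    opT k' μ ν (Lp.compMeasurePreserving τ hτ v) = opT k μ ν v := by
  rw [opT_eq_toLp, opT_eq_toLp]
  congr 1
  ext x
  simp only [evalTC_apply, evalT_eq_integral]
  have hv : ((Lp.compMeasurePreserving τ hτ v : Lp ℂ 2 ν) : Y → ℂ) =ᵐ[ν] fun y => v (τ y) :=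
    Lp.coeFn_compMeasurePreserving v hτ
  calc ∫ y, k' (x, y) * (Lp.compMeasurePreserving τ hτ v : Lp ℂ 2 ν) y ∂ν
      = ∫ y, k' (x, y) * v (τ y) ∂ν := by
        apply integral_congr_ae
        filter_upwards [hv] with y hy
        rw [hy]
    _ = ∫ y, k (x, y) * v y ∂ν := integral_kernel_comp_eq hτ hτe k k' hk v x

end OnX

end Kernel

end KernelOperator
end PerL34
end HodgeCM

end
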